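import Summits.HodgeConjecture.CorCM.D2Bridge.PrintedCitationHypothesesT   -- the CERTIFICATE MODULE: `HypDel`/`Hyp21`/`HypLiu418`/`Hyp413`/`Hyp411`/`HypD3`/`HypD1pp` (binder texts of record)
import Summits.HodgeConjecture.HodgeConjecture.Theorems.HCCMNonvacuityGaloisDatumCyc7   -- ★ p810711 NONVAC-II: the Galois datum `ℚ(ζ₇)` (Landherr `V`, `a`, `Φ`, `ν`)
import Summits.HodgeConjecture.HodgeConjecture.Theorems.HCCMUnconditionalHDelOfF0   -- ★ p807981 `HDel_holds` (binder `hDel` discharged)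
import HarnessLib

/-!
# The ∀-telescopes of the printed-citation hypotheses are INHABITED — literal certificates (`Hyp411`, `HypD3`, `HypD1pp`)

Cell `hodgecm-mathlib`, director g15 s459 ∕ s462 (a) ROW «NONVAC-II §3 — TELESCOPE CERTIFICATES» (sequel of ★ p810711
`Theorems/HCCMNonvacuityGaloisDatumCyc7.lean`).  HONEST LABEL: HC_CM is proved only modulo the 7 printed citations until rung 0 closes; this
file proves NOTHING about Hodge classes and discharges no binder.  It certifies, LITERALLY, that three of the five ∀-statements
`Hyp411` ∕ `HypD3` ∕ `HypD1pp` of `CorCM/D2Bridge/PrintedCitationHypothesesT.lean` (binders `h411` ∕ `hD3` ∕ `hD1''` of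
`hc_cm_of_printed_citations_muKey_ident_lemD3_delRecConjOmegaT`, all three already discharged as items 24836 ∕ 24837 ∕ 24838) are NOT
vacuously true: for each, the statement obtained by copying its ∀-telescope BYTE FOR BYTE and replacing the conclusion by `False` is REFUTED,
i.e. the telescope has a joint instance — `¬ (∀ ‹binders verbatim›, False)` (equivalently `∃ ‹binders›, True`).

The joint witness (every token a ★ theorem of the tree; no hypothesis): `hDel := HDel_holds` (★ p807981); `F := HodgeCM.cyclo7 = ℚ(ζ₇)`
(Galois, `[F:ℚ] = 6`; ★ `HodgeCM/Model/Inhabited.lean`); `ι₁ := w.embedding` for an infinite place `w`; `V` by Landherr's existence theorem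
★ `HodgeCM.landherr_exists_proof`; `a := 1 : RealScalar F`; `Φ := HodgeCM.stdCMType F ∋ ι₁`; `(μ, hμ, hw)` a conjugate-symplectic weight-one
character ★ `Liu2021.LemD1IndexedNonVacuityNonsplitPlace.exists_isConjugateSymplectic_hasWeight_one` ([Liu2021] Def. 4.1 ∕ 4.3); `v` any prime
of `𝓞 F⁺` (`Ideal.exists_maximal`, `RingOfIntegers.not_isField`); `j` an admissible index of the Appendix-C datum ★
`Thm418Data.nonempty_admIndex` at the trivial automorphic character ★ `Def411WeilCarriers.isAutomorphicOneChar_one` ([Liu2021] Def. 4.11 ∕ 4.12).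
The two REMAINING binders `HypLiu418` (`(R′, hR′, Φ′)` tail) and `Hyp413` (`i : I V (repAt a₀) (muLiu ι₁ GramClass.rep)` tail) follow in the
sequel, against B-p18 (g23)'s NONVAC-III parametric tails (director s460 ∕ s462 (b)).

0 `def`, 0 `instance`, 0 `notation`, 0 `axiom`, 0 `sorry`; theorems only; the `open` block is the certificate module's, verbatim, so that
the copied binder texts parse to the same terms.  Filed `--kind proof --supports stmt-HodgeConjecture-24832 --as helper`.
-/

set_option autoImplicit false

noncomputable section

namespace Summit.HodgeConjecture.HodgeConjecture.Theorems.HCCMNonvacuityBinderTelescopes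

open scoped TensorProduct Matrix
open NumberField NumberField.InfinitePlace
open HodgeCM.Model HodgeCM.Model.LiuIndex HodgeCM.Model.TowerCarrier
open HodgeCM.Literature.Theta.LiuAlbaneseModuleDatum.D2Bridge (HcmPieces)
open Summit.HodgeConjecture.CorCM.Model
open Literature.AlgebraicGeometry.Motives (CMType)
open Literature.AlgebraicGeometry.HodgeTheory Literature.NumberTheory.Automorphic.PicardCM
open Literature.AlgebraicGeometry.ShimuraVarieties.UnitaryCanonicalModel
open Literature.NumberTheory.ComplexMultiplication
open Literature.NumberTheory.Automorphic
open Literature.NumberTheory.Automorphic.IdeleClassGroup (toHeckeCharacter isUnitary_toHeckeCharacter galConj)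
open Literature.NumberTheory.Automorphic.Liu2021 Literature.NumberTheory.Automorphic.Liu2021.AppendixC
open Literature.NumberTheory.Automorphic.Liu2021.AppendixC.RestOne
open Literature.NumberTheory.Automorphic.Liu2021.Def411WeilCarriers (lineOf locF Rep)
open Summit.HodgeConjecture.CorCM.Transposition.OmegaTransport (realUnit)
open HodgeCM.Model.ArchSideTerm (e₁)
open Literature.NumberTheory.GelbartRogawski1991 Literature.NumberTheory.GelbartRogawski1991.UnitaryDualPair
open Literature.NumberTheory.GelbartRogawski1991.UnitaryDualPair.LocalSplitting (localMu norm_localMu continuous_localMu localMu_toLocalRing_eq_one_iff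
  eq_of_forall_localMu_toHeckeCharacter_eq)
open Literature.RepresentationTheory Literature.RepresentationTheory.Liu2021
open Summit.HodgeConjecture.CorCM.Transposition
open Summit.HodgeConjecture.CorCM.D2Bridge.AdapterMuConj (muConj prop413AsPrinted_muConj def411_muConj nontrivial_omegaAt_muConj_rest)
open Summit.HodgeConjecture.CorCM.D2Bridge.MuKeyIdentEnd (hc_cm_of_printed_citations_muKey_ident)
open Summit.HodgeConjecture.CorCM.D2Bridge.MuKeyIdentLemD3End
open Summit.HodgeConjecture.CorCM.D2Bridge.MuKeyIdentLemD3DelRecConjOmegaEnd (diagonal_frameD_map_complexConj)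
open Summit.HodgeConjecture.CorCM.D2Bridge.MuKeyIdentLemD3DelRecConjOmegaEndT

set_option linter.dupNamespace false in
/-- **`Hyp411`'s ∀-telescope is inhabited** (binders `hDel, F, [IsGalois ℚ F], h6, ι₁, V, a, Φ, hΦ, μ, hμ, hw` copied byte for byte from `PrintedCitationHypothesesT.Hyp411`, conclusion replaced by `False`, the whole refuted): witness `HDel_holds`, `ℚ(ζ₇)`, Landherr's `V`, `a = 1`, the standard CM type, a conjugate-symplectic weight-one `μ`.  So the discharged `h411` (item 24836) was not discharged vacuously. [cite: Liu2021, Def 4.11 pp. 48–49; Def. 4.1 (l. 1900–1902) and Def. 4.3] -/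
theorem hyp411_telescope_inhabited :
    ¬ (∀ (hDel : Literature.AlgebraicGeometry.ShimuraVarieties.UnitaryCanonicalModel.canonicalModel_exists_printed),
      ∀ (F : HodgeCM.CMField) [IsGalois ℚ F] (h6 : 6 ≤ Module.finrank ℚ F) {ι₁ : F →+* ℂ} (V : HodgeCM.HermSpace3 F ι₁) (a : RealScalar F)
      (Φ : CMType F) (hΦ : ι₁ ∈ Φ.1) (μ : Literature.NumberTheory.Automorphic.IdeleClassGroup (F : Type) →ₜ* Circle)
      (hμ : IdeleClassGroup.IsConjugateSymplectic (F : Type) μ) (hw : IdeleClassGroup.HasWeight (F : Type) μ 1),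
      False) := by
  intro h
  obtain ⟨w⟩ := (inferInstance : Nonempty (InfinitePlace (HodgeCM.cyclo7 : Type)))
  obtain ⟨V⟩ := HodgeCM.landherr_exists_proof HodgeCM.cyclo7 w.embedding
  obtain ⟨μ, hμ, hw⟩ := Literature.NumberTheory.Automorphic.Liu2021.LemD1IndexedNonVacuityNonsplitPlace.exists_isConjugateSymplectic_hasWeight_one (HodgeCM.cyclo7 : Type)
  haveI : IsGalois ℚ HodgeCM.cyclo7 := HodgeCM.cyclo7_isGalois
  exact h Summit.HodgeConjecture.HodgeConjecture.Theorems.HCCMUnconditionalHDelOfF0.HDel_holds HodgeCM.cyclo7 Summit.HodgeConjecture.HodgeConjecture.Theorems.HCCMNonvacuityGaloisDatumCyc7.six_le_finrank_cyclo7 V ⟨1, map_one _, one_ne_zero⟩ (HodgeCM.stdCMType HodgeCM.cyclo7) ⟨w, rfl⟩ μ hμ hw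

set_option linter.dupNamespace false in
/-- **`HypD3`'s ∀-telescope is inhabited** (binders `hDel, F, [IsGalois ℚ F], h6, ι₁, V, a, Φ, hΦ, v` byte for byte from `PrintedCitationHypothesesT.HypD3`, conclusion `False`, refuted): the `Hyp411` witness plus any prime `v` of `𝓞 F⁺` (`Ideal.exists_maximal`; `𝓞 F⁺` is not a field).  So the discharged `hD3` (item 24837) was not discharged vacuously. [cite: Liu2021, App. D Lem D.1 (3) pp. 86–87] -/
theorem hypD3_telescope_inhabited :
    ¬ (∀ (hDel : Literature.AlgebraicGeometry.ShimuraVarieties.UnitaryCanonicalModel.canonicalModel_exists_printed),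
      ∀ (F : HodgeCM.CMField) [IsGalois ℚ F] (h6 : 6 ≤ Module.finrank ℚ F) {ι₁ : F →+* ℂ} (V : HodgeCM.HermSpace3 F ι₁) (a : RealScalar F)
      (Φ : CMType F) (hΦ : ι₁ ∈ Φ.1) (v : IsDedekindDomain.HeightOneSpectrum (𝓞 ↥(maximalRealSubfield (F : Type)))),
      False) := by
  intro h
  obtain ⟨w⟩ := (inferInstance : Nonempty (InfinitePlace (HodgeCM.cyclo7 : Type)))
  obtain ⟨V⟩ := HodgeCM.landherr_exists_proof HodgeCM.cyclo7 w.embedding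
  haveI : IsGalois ℚ HodgeCM.cyclo7 := HodgeCM.cyclo7_isGalois
  obtain ⟨P, hP⟩ := Ideal.exists_maximal (𝓞 ↥(maximalRealSubfield (HodgeCM.cyclo7 : Type)))
  have hv : P ≠ ⊥ := Ring.ne_bot_of_isMaximal_of_not_isField hP (RingOfIntegers.not_isField _)
  exact h Summit.HodgeConjecture.HodgeConjecture.Theorems.HCCMUnconditionalHDelOfF0.HDel_holds HodgeCM.cyclo7 Summit.HodgeConjecture.HodgeConjecture.Theorems.HCCMNonvacuityGaloisDatumCyc7.six_le_finrank_cyclo7 V ⟨1, map_one _, one_ne_zero⟩ (HodgeCM.stdCMType HodgeCM.cyclo7) ⟨w, rfl⟩ ⟨P, hP.isPrime, hv⟩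

set_option linter.dupNamespace false in
/-- **`HypD1pp`'s ∀-telescope is inhabited** (binders `hDel, F, [IsGalois ℚ F], h6, ι₁, V, a, Φ, hΦ, μ, hμ, hw, j, v` byte for byte from `PrintedCitationHypothesesT.HypD1pp`, conclusion `False`, refuted): the `Hyp411` witness, an admissible index `j` of the Appendix-C `Thm418Data` at `(μ, hμ, hw)` (★ `Thm418Data.nonempty_admIndex` at the trivial automorphic character of `E¹\\(𝔸_E^∞)¹`, ★ `Def411WeilCarriers.isAutomorphicOneChar_one`), and a prime `v` of `𝓞 F⁺`.  So the discharged `hD1''` (item 24838) was not discharged vacuously. [cite: Liu2021, App. D Lem D.1 (1) pp. 86–87; Def. 4.11 (l. 2090) and Def. 4.12] -/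
theorem hypD1pp_telescope_inhabited :
    ¬ (∀ (hDel : Literature.AlgebraicGeometry.ShimuraVarieties.UnitaryCanonicalModel.canonicalModel_exists_printed),
      ∀ (F : HodgeCM.CMField) [IsGalois ℚ F] (h6 : 6 ≤ Module.finrank ℚ F) {ι₁ : F →+* ℂ} (V : HodgeCM.HermSpace3 F ι₁) (a : RealScalar F)
      (Φ : CMType F) (hΦ : ι₁ ∈ Φ.1) (μ : Literature.NumberTheory.Automorphic.IdeleClassGroup (F : Type) →ₜ* Circle)
      (hμ : IdeleClassGroup.IsConjugateSymplectic (F : Type) μ) (hw : IdeleClassGroup.HasWeight (F : Type) μ 1)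
      (j : (toThm418Data _ (restOfCharDeltaPrime (Summit.HodgeConjecture.CorCM.DelRec.exists_recordSystem_of_printed hDel) ⟨HodgeCM.CMField.K F⟩ h6 ι₁ ⟨HodgeCM.HermSpace3.Hm V, HodgeCM.HermSpace3.isHermitian V, HodgeCM.HermSpace3.signature_ι₁ V, HodgeCM.HermSpace3.posDef_of_ne V⟩ Φ e₁ (frameD V) (frameD_real V) (frameD_ne V) (ιVE V) (Rep.update ↥(maximalRealSubfield (HodgeCM.CMField.K F)) (imagUnitSq (HodgeCM.CMField.K F)) (Rep.ofLineOf ↥(maximalRealSubfield (HodgeCM.CMField.K F)) (imagUnitSq (HodgeCM.CMField.K F))) (locF ↥(maximalRealSubfield (HodgeCM.CMField.K F)) (imagUnitSq (HodgeCM.CMField.K F)) (realUnit ⟨HodgeCM.CMField.K F⟩ a.1 a.2.1 a.2.2)) (realUnit ⟨HodgeCM.CMField.K F⟩ a.1 a.2.1 a.2.2) rfl) μ hμ hw)).AdmIndex) (v : IsDedekindDomain.HeightOneSpectrum (𝓞 ↥(maximalRealSubfield (F : Type)))),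
      False) := by
  intro h
  obtain ⟨w⟩ := (inferInstance : Nonempty (InfinitePlace (HodgeCM.cyclo7 : Type)))
  obtain ⟨V⟩ := HodgeCM.landherr_exists_proof HodgeCM.cyclo7 w.embedding
  obtain ⟨μ, hμ, hw⟩ := Literature.NumberTheory.Automorphic.Liu2021.LemD1IndexedNonVacuityNonsplitPlace.exists_isConjugateSymplectic_hasWeight_one (HodgeCM.cyclo7 : Type)
  haveI : IsGalois ℚ HodgeCM.cyclo7 := HodgeCM.cyclo7_isGalois
  obtain ⟨P, hP⟩ := Ideal.exists_maximal (𝓞 ↥(maximalRealSubfield (HodgeCM.cyclo7 : Type)))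
  have hv : P ≠ ⊥ := Ring.ne_bot_of_isMaximal_of_not_isField hP (RingOfIntegers.not_isField _)
  obtain ⟨j⟩ := Literature.NumberTheory.Automorphic.Liu2021.Thm418Data.nonempty_admIndex
    (D := toThm418Data _ (restOfCharDeltaPrime (Summit.HodgeConjecture.CorCM.DelRec.exists_recordSystem_of_printed Summit.HodgeConjecture.HodgeConjecture.Theorems.HCCMUnconditionalHDelOfF0.HDel_holds)
      ⟨HodgeCM.CMField.K HodgeCM.cyclo7⟩ Summit.HodgeConjecture.HodgeConjecture.Theorems.HCCMNonvacuityGaloisDatumCyc7.six_le_finrank_cyclo7 w.embedding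
      ⟨HodgeCM.HermSpace3.Hm V, HodgeCM.HermSpace3.isHermitian V, HodgeCM.HermSpace3.signature_ι₁ V, HodgeCM.HermSpace3.posDef_of_ne V⟩
      (HodgeCM.stdCMType HodgeCM.cyclo7) e₁ (frameD V) (frameD_real V) (frameD_ne V) (ιVE V)
      (Rep.update ↥(maximalRealSubfield (HodgeCM.CMField.K HodgeCM.cyclo7)) (imagUnitSq (HodgeCM.CMField.K HodgeCM.cyclo7))
        (Rep.ofLineOf ↥(maximalRealSubfield (HodgeCM.CMField.K HodgeCM.cyclo7)) (imagUnitSq (HodgeCM.CMField.K HodgeCM.cyclo7)))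
        (locF ↥(maximalRealSubfield (HodgeCM.CMField.K HodgeCM.cyclo7)) (imagUnitSq (HodgeCM.CMField.K HodgeCM.cyclo7))
          (realUnit ⟨HodgeCM.CMField.K HodgeCM.cyclo7⟩ (1 : HodgeCM.cyclo7) (map_one _) one_ne_zero))
        (realUnit ⟨HodgeCM.CMField.K HodgeCM.cyclo7⟩ (1 : HodgeCM.cyclo7) (map_one _) one_ne_zero) rfl) μ hμ hw))
    ⟨1, Literature.NumberTheory.Automorphic.Liu2021.Def411WeilCarriers.isAutomorphicOneChar_one _ _ _⟩
  exact h Summit.HodgeConjecture.HodgeConjecture.Theorems.HCCMUnconditionalHDelOfF0.HDel_holds HodgeCM.cyclo7 Summit.HodgeConjecture.HodgeConjecture.Theorems.HCCMNonvacuityGaloisDatumCyc7.six_le_finrank_cyclo7 V ⟨1, map_one _, one_ne_zero⟩ (HodgeCM.stdCMType HodgeCM.cyclo7) ⟨w, rfl⟩ μ hμ hw j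
    ⟨P, hP.isPrime, hv⟩

end Summit.HodgeConjecture.HodgeConjecture.Theorems.HCCMNonvacuityBinderTelescopes

end
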